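import Literature.NumberTheory.EllipticCurves.WeightOneEtaQuotientsProofs
import HarnessLib

/-!
# `η`-quotients that are (non-cuspidal) modular forms on `Γ₀(N)`, and the level-6 forms of the
# Domb / four-step-walk parametrisation

The tree's `Literature/NumberTheory/EllipticCurves/ModularCurveEtaQuotientsProofs.lean` proves
Newman's criterion (`etaQuotient_smul_of_mem_Gamma0`: `Γ₀(N)`-invariance in even weight `k` under
`NewmanCond N r k`) and Ligozat's cusp analysis (`isZeroAtImInfty_etaQuotient_slash`,
`etaQuotientCuspForm`; the non-strict form `isBoundedAtImInfty_etaQuotient_slash` — order `≥ 0` at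
a cusp ⇒ bounded there — is in `WeightOneEtaQuotientsProofs.lean`, where it serves the theta-type
`Γ₁(N)` forms). This file packages the `Γ₀(N)` / Newman version
`etaQuotientModularForm : ModularForm (Gamma0 N) k` and instantiates it at level `6`:

* `Literature.NumberTheory.ModularForms.dombModularForm : ModularForm (Gamma0 6) 2`, the form
  `Z(τ) = η(τ)⁴η(3τ)⁴/(η(2τ)²η(6τ)²)` of the modular parametrisation of the Domb series
  `y₀(−η(2τ)⁶η(6τ)⁶/(η(τ)⁶η(3τ)⁶)) = η(τ)⁴η(3τ)⁴/(η(2τ)²η(6τ)²)` (Chan–Zudilin;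
  [BorweinEtAl2012, §4 Remark 7, eq. (y0modular)]) — Newman's conditions
  (`Σ r_δ = 4`, `Σ δr_δ = 0`, `Σ (6/δ)r_δ = 24`, `∏ δ^{|r_δ|} = 108²`) and Ligozat's orders
  `(4, 0, 12, 0) ≥ 0` at the cusps `1, 1/2, 1/3, ∞` are a decidable certificate;
* `dombHauptmodul_smul` — the argument `t(τ) = (η(2τ)η(6τ)/(η(τ)η(3τ)))⁶` is
  `Γ₀(6)`-invariant (weight `0`; Newman's conditions `Σ r_δ = 0`, `Σ δ r_δ = 24`,
  `Σ (6/δ) r_δ = −24`, `∏ δ^{|r_δ|} = (6⁶)²`).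

These are the two modular objects entering the proof of [BorweinEtAl2012, Thm. 9] (via (4.14) and
the CM point `τ = (√(−5/3) − 1)/2`); everything here is proved.

## References

* [BorweinEtAl2012] J. M. Borwein, A. Straub, J. Wan, W. Zudilin, *Densities of short uniform
  random walks*, Canad. J. Math. 64 (2012) 961–990 (arXiv:1103.2995), §4 Remark 7.
* H. H. Chan, W. Zudilin, *New representations for Apéry-like sequences*, Mathematika 56 (2010)
  107–117.
* [Savitt2025] D. Savitt, *An elementary proof of Newman's eta-quotient theorem*, Thm. 1, Rem. 2.
-/

noncomputable section

open UpperHalfPlane hiding I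
open ModularForm Complex Matrix.SpecialLinearGroup Filter Asymptotics CongruenceSubgroup
open scoped MatrixGroups Real ModularForm CongruenceSubgroup Topology Manifold NumberTheorySymbols
open Literature.NumberTheory.EllipticCurves.ModularForms

namespace Literature.NumberTheory.ModularForms

/-! ### `η`-quotients as modular forms -/

/-- **The modular form `∏_{δ ∣ N} η(δτ)^{r_δ} ∈ M_k(Γ₀(N))`** attached to an exponent vector
satisfying Newman's conditions (`Γ₀(N)`-invariance, `k` even) and Ligozat's non-negativity at
every cusp (`cuspOrder24 N r t ≥ 0` for all `t ∣ N`). [cite: Savitt2025, Thm. 1 and Rem. 2] -/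
def etaQuotientModularForm (N : ℕ) [NeZero N] (r : ℕ → ℤ) (k : ℤ) (hkeven : Even k)
    (hc : NewmanCond N r k) (hord : ∀ t ∈ N.divisors, 0 ≤ cuspOrder24 N r t) :
    ModularForm (Gamma0 N) k where
  toFun := etaQuotient N r
  slash_action_eq' A hA := by
    obtain ⟨γ, hγ, rfl⟩ := hA
    exact etaQuotient_slash_of_mem_Gamma0 N (NeZero.pos N) r k hkeven hc hγ
  holo' := mdifferentiable_etaQuotient N r
  bdd_at_cusps' hcusp := by
    rw [Subgroup.IsArithmetic.isCusp_iff_isCusp_SL2Z] at hcusp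
    rw [OnePoint.isBoundedAt_iff_forall_SL2Z hcusp]
    intro γ _
    exact isBoundedAtImInfty_etaQuotient_slash N (NeZero.pos N) r k hc.sum_eq γ
      (cuspOrder24_nonneg_of_forall_divisors N (NeZero.ne N) r hord _)

/-- The underlying function. [folklore] -/
theorem coe_etaQuotientModularForm (N : ℕ) [NeZero N] (r : ℕ → ℤ) (k : ℤ) (hkeven : Even k)
    (hc : NewmanCond N r k) (hord : ∀ t ∈ N.divisors, 0 ≤ cuspOrder24 N r t) :
    (etaQuotientModularForm N r k hkeven hc hord : ℍ → ℂ) = etaQuotient N r := rfl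

/-! ### Level 6: the Domb / four-step-walk forms -/

/-- The exponent vector of `Z(τ) = η(τ)⁴η(3τ)⁴/(η(2τ)²η(6τ)²)`. [cite: BorweinEtAl2012, §4 Remark 7] -/
def dombExponents : ℕ → ℤ := fun δ =>
  if δ = 1 then 4 else if δ = 2 then -2 else if δ = 3 then 4 else if δ = 6 then -2 else 0

/-- The exponent vector of `t(τ) = (η(2τ)η(6τ)/(η(τ)η(3τ)))⁶`.
[cite: BorweinEtAl2012, §4 Remark 7] -/
def dombHauptmodulExponents : ℕ → ℤ := fun δ =>
  if δ = 1 then -6 else if δ = 2 then 6 else if δ = 3 then -6 else if δ = 6 then 6 else 0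

/-- Newman's conditions for `Z` in weight `2`: `Σ r_δ = 4`, `24 ∣ Σ δ r_δ = 0`,
`24 ∣ Σ (6/δ) r_δ = 24`, `∏ δ^{|r_δ|} = 11664 = 108²`. [cite: Savitt2025, Thm. 1] -/
theorem newmanCond_dombExponents : NewmanCond 6 dombExponents 2 := by
  refine ⟨by decide, by decide, by decide, ⟨108, by decide⟩⟩

/-- Ligozat's orders of `Z` at the cusps of `Γ₀(6)` are `≥ 0` (namely `96, 0, 96, 0`
at `t = 1, 2, 3, 6`). [cite: Savitt2025, Rem. 2] -/
theorem cuspOrder24_dombExponents_nonneg :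
    ∀ t ∈ (6 : ℕ).divisors, 0 ≤ cuspOrder24 6 dombExponents t := by
  decide

/-- **The weight-2 modular form `Z(τ) = η(τ)⁴η(3τ)⁴/(η(2τ)²η(6τ)²)` on `Γ₀(6)`** — the modular
form of the Chan–Zudilin parametrisation of the Domb series
`y₀(−η(2τ)⁶η(6τ)⁶/(η(τ)⁶η(3τ)⁶)) = Z(τ)` [BorweinEtAl2012, §4 Remark 7].
[cite: BorweinEtAl2012, §4 Remark 7 (eq. y0modular)] -/
def dombModularForm : ModularForm (Gamma0 6) 2 :=
  etaQuotientModularForm 6 dombExponents 2 (by decide) newmanCond_dombExponents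
    cuspOrder24_dombExponents_nonneg

/-- The underlying function of `dombModularForm` is the `η`-quotient. [folklore] -/
theorem coe_dombModularForm : (dombModularForm : ℍ → ℂ) = etaQuotient 6 dombExponents := rfl

/-- Newman's conditions for `t` in weight `0`: `Σ r_δ = 0`, `Σ δ r_δ = 24`, `Σ (6/δ) r_δ = −24`,
`∏ δ^{|r_δ|} = 6¹² = (6⁶)²`. [cite: Savitt2025, Thm. 1] -/
theorem newmanCond_dombHauptmodulExponents : NewmanCond 6 dombHauptmodulExponents 0 := by
  refine ⟨by decide, by decide, by decide, ⟨6 ^ 6, by decide⟩⟩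

/-- **`t(τ) = (η(2τ)η(6τ)/(η(τ)η(3τ)))⁶` is `Γ₀(6)`-invariant** (a modular function of level `6`;
minus the argument of `y₀` in [BorweinEtAl2012, §4 Remark 7]). [cite: BorweinEtAl2012, §4 Remark 7] -/
theorem dombHauptmodul_smul {γ : SL(2, ℤ)} (hγ : γ ∈ Gamma0 6) (τ : ℍ) :
    etaQuotient 6 dombHauptmodulExponents (γ • τ) = etaQuotient 6 dombHauptmodulExponents τ := by
  have h := etaQuotient_smul_of_mem_Gamma0 6 (by norm_num) dombHauptmodulExponents 0 (by decide)
    newmanCond_dombHauptmodulExponents hγ τ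
  simpa using h

/-- **`Z(γτ) = (cτ + d)² Z(τ)` for `γ ∈ Γ₀(6)`.** [cite: BorweinEtAl2012, §4 Remark 7] -/
theorem dombModularForm_smul {γ : SL(2, ℤ)} (hγ : γ ∈ Gamma0 6) (τ : ℍ) :
    etaQuotient 6 dombExponents (γ • τ) =
      ((γ 1 0 : ℂ) * τ + γ 1 1) ^ (2 : ℤ) * etaQuotient 6 dombExponents τ :=
  etaQuotient_smul_of_mem_Gamma0 6 (by norm_num) dombExponents 2 (by decide)
    newmanCond_dombExponents hγ τ

end Literature.NumberTheory.ModularForms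

end
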